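import Literature.NumberTheory.Automorphic.LocalHermitianFormsRankThree
import Literature.NumberTheory.Automorphic.UnitaryGroupFormCongrFinSum
import Literature.NumberTheory.Automorphic.LocalUnitaryGroupCongr
import Literature.NumberTheory.Automorphic.UnitaryGroupFrameSubform
import HarnessLib

/-!
# Rank-3 hermitian forms over a local quadratic FIELD extension are classified by the norm class of the discriminant
# (Jacobowitz (1962), Thm. 3.1; Rogawski (1990), §14.2 p. 232 (i), §3.5 p. 29)

Topic `NumberTheory/Automorphic`; namespace `Literature.NumberTheory.Automorphic.UnitaryGroup`; THEOREMS ONLY (no definition, no instance,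
no named fact, no `sorry`).  The half of the local comparison that ★ `LocalUnitaryGroupCongr` records as «NOT here: the classification of
hermitian forms over a local quadratic FIELD extension in odd rank», in the rank the T1 engine line uses (`N = 3`).

WHAT IS PROVED.
* §1 (any commutative ring `R` with `σ : R →+* R`, any `n`): the DISCRIMINANT of a congruent form is the discriminant times a NORM
  (★ `UnitaryGroup.det_formCongr`, read as `exists_isUnit_det_eq_of_formCongr_eq`), and congruence by the SCALAR frame `z • 1` multiplies the
  form by the norm `σ z · z` (`formCongr_scalar_eq_smul`).
* §2 (a field `K` with an involution `σ`, rank `3`): two non-degenerate forms each SIMILAR to a common form `Φ` by `σ`-fixed scalars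
  (`ᵗσ(T) H T = a • Φ`, `ᵗσ(T′) H′ T′ = a′ • Φ`, `σ a = a`, `σ a′ = a′`) are CONGRUENT iff their discriminants differ by a norm:
  **`nonempty_formCongr_eq_iff_exists_det_eq_of_similar`** — `(∃ U, ᵗσ(U) H U = H′) ↔ ∃ z ≠ 0, det H′ = σ z · z · det H`.  ((→) is §1; (←):
  `(a′/a)³` is a norm by §1 and `(a′/a)² = σ(a′/a) · (a′/a)` is a norm because `a′/a` is `σ`-fixed, so `a′/a = σ u · u` and the scalar frame `u • 1`
  carries `a • Φ` to `a′ • Φ`.)  Odd rank is what makes the square drop out.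
* §3 (a quadratic extension of number fields `E/F` with `c ≠ 1`, a finite place `v` of `F` and a NON-SPLIT `w ∣ v`, so `E_v = E ⊗_F F_v` is a field,
  ★ `LocalRing.isField_of_smul_eq`): for non-degenerate `c`-hermitian `H, H′ ∈ M₃(E)`,
  **`nonempty_formCongr_map_eq_iff_exists_det_eq_of_smul_eq`** — `(∃ T ∈ GL₃(E_v), ᵗ(c⊗1)(T) · H_v · T = H′_v) ↔ ∃ z ∈ E_vˣ, det H′_v = (c⊗1) z · z · det H_v`
  (both forms are `≅ a • Φ₃` by ★ `exists_formCongr_map_eq_smul_antidiag_of_smul_eq`, then §2): rank-3 hermitian forms at a non-split place are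
  CLASSIFIED BY THE DISCRIMINANT in `F_vˣ ∕ N(E_wˣ)` — two classes ([Jacobowitz1962, Thm. 3.1]; the input of [Rogawski1990, §3.5]'s description of
  `𝔇(T∕F_v)` as «the twists `H_c` isomorphic to `H`» and of §14.2 (i)).

## References
* R. Jacobowitz, *Hermitian forms over local fields*, Amer. J. Math. 84 (1962), §3 Thm. 3.1 [Jacobowitz1962].
* J. D. Rogawski, *Automorphic Representations of Unitary Groups in Three Variables*, Ann. of Math. Stud. 123 (1990), §3.5 p. 29, §14.2 p. 232
  [Rogawski1990].
* J. Dieudonné, *La géométrie des groupes classiques*, 3e éd. (1971), Chap. II §5 [Dieudonne1971GroupesClassiques].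
-/

set_option autoImplicit false

noncomputable section

open Matrix NumberField IsDedekindDomain

namespace Literature.NumberTheory.Automorphic.UnitaryGroup

/-! ## §1 Discriminants under congruence; the scalar frame -/

section Ring

variable {R : Type*} [CommRing R] {n : Type*} [Fintype n] [DecidableEq n] (σ : R →+* R)

/-- The SCALAR FRAME `z • 1 ∈ GL_n(R)` of a unit `z`. [cite: Jacobowitz1962, §3 Thm. 3.1] -/
theorem coe_units_map_scalar (z : Rˣ) :
    ((Units.map ((Matrix.scalar n : R →+* Matrix n n R) : R →* Matrix n n R) z : GL n R) : Matrix n n R) =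
      (z : R) • (1 : Matrix n n R) := by
  rw [Units.coe_map, MonoidHom.coe_coe, Matrix.scalar_apply, Matrix.smul_one_eq_diagonal]

/-- **Congruence by a scalar frame multiplies the form by a norm**: `ᵗσ(z • 1) · H · (z • 1) = (σ z · z) • H`. [cite: Jacobowitz1962, §3 Thm. 3.1] -/
theorem formCongr_scalar_eq_smul (z : Rˣ) (H : Matrix n n R) :
    formCongr σ (Units.map ((Matrix.scalar n : R →+* Matrix n n R) : R →* Matrix n n R) z) H = (σ z * z) • H := by
  rw [formCongr, coe_units_map_scalar, Matrix.map_smul' σ _ _ (map_mul σ), Matrix.map_one σ (map_zero σ) (map_one σ),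
    Matrix.transpose_smul, Matrix.transpose_one, Matrix.smul_mul, Matrix.one_mul, Matrix.mul_smul, Matrix.mul_one, smul_smul]
  congr 1
  ring

/-- **(→) of the classification, over any commutative ring**: congruent forms have discriminants differing by a norm of a unit.
[cite: Jacobowitz1962, §3 Thm. 3.1] -/
theorem exists_isUnit_det_eq_of_formCongr_eq {T : GL n R} {H H' : Matrix n n R} (h : formCongr σ T H = H') :
    ∃ z : R, IsUnit z ∧ H'.det = σ z * z * H.det :=
  ⟨(T : Matrix n n R).det, (Matrix.isUnits_det_units T), by rw [← h, det_formCongr]; ring⟩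

end Ring

/-! ## §2 Over a field with an involution: two forms similar to a common form by `σ`-fixed scalars are congruent iff their discriminants
differ by a norm (rank `3`) -/

section Field

variable {K : Type*} [Field K] (σ : K →+* K)

/-- **A `σ`-fixed scalar whose cube is a norm is a norm**: `σ x = x`, `x ≠ 0`, `x³ = σ y · y` ⇒ `x = σ u · u` with `u = y / x` (`x² = σ x · x`).
[cite: Jacobowitz1962, §3 Thm. 3.1] -/
theorem exists_eq_norm_of_pow_three_eq_norm {x y : K} (hx : σ x = x) (hx0 : x ≠ 0) (h : x ^ 3 = σ y * y) :
    ∃ u : K, u ≠ 0 ∧ x = σ u * u := by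
  have hy0 : y ≠ 0 := by
    rintro rfl
    rw [mul_zero] at h
    exact pow_ne_zero 3 hx0 h
  refine ⟨y / x, div_ne_zero hy0 hx0, ?_⟩
  rw [map_div₀, hx, div_mul_div_comm, ← h, eq_div_iff (mul_ne_zero hx0 hx0)]
  ring

/-- **Rank-3 forms similar to a common form are congruent iff their discriminants differ by a norm.**  `σ` an involution of the field `K`,
`Φ, H, H′ ∈ M₃(K)` with `det Φ ≠ 0`, `ᵗσ(T) H T = a • Φ` and `ᵗσ(T′) H′ T′ = a′ • Φ` for `σ`-fixed non-zero scalars `a, a′`.  Then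
`(∃ U, ᵗσ(U) H U = H′) ↔ ∃ z ≠ 0, det H′ = σ z · z · det H`. [cite: Jacobowitz1962, §3 Thm. 3.1] [cite: Rogawski1990, §3.5 p. 29] -/
theorem nonempty_formCongr_eq_iff_exists_det_eq_of_similar {Φ H H' : Matrix (Fin 3) (Fin 3) K} (hΦ : Φ.det ≠ 0)
    {T T' : GL (Fin 3) K} {a a' : K} (ha0 : a ≠ 0) (ha : σ a = a) (ha0' : a' ≠ 0) (ha' : σ a' = a')
    (hT : formCongr σ T H = a • Φ) (hT' : formCongr σ T' H' = a' • Φ) :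
    (∃ U : GL (Fin 3) K, formCongr σ U H = H') ↔ ∃ z : K, z ≠ 0 ∧ H'.det = σ z * z * H.det := by
  constructor
  · rintro ⟨U, hU⟩
    obtain ⟨z, hz, h⟩ := exists_isUnit_det_eq_of_formCongr_eq σ hU
    exact ⟨z, hz.ne_zero, h⟩
  · rintro ⟨z, hz0, hz⟩
    -- discriminants: `a³ det Φ = N(det T) det H`, `a′³ det Φ = N(det T′) det H′ = N(det T′) N(z) det H`
    have hdT := det_formCongr σ T H
    have hdT' := det_formCongr σ T' H'
    rw [hT, det_smul, Fintype.card_fin] at hdT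
    rw [hT', det_smul, Fintype.card_fin, hz] at hdT'
    have hdetH : H.det ≠ 0 := by
      intro h0
      rw [h0, mul_zero, zero_mul] at hdT
      exact mul_ne_zero (pow_ne_zero 3 ha0) hΦ hdT
    have hdetT : (T : Matrix (Fin 3) (Fin 3) K).det ≠ 0 := (Matrix.isUnits_det_units T).ne_zero
    -- the σ-fixed ratio `x = a′ / a` has `x³ = N(y)`, `y = det T′ · z / det T`
    have hσx : σ (a' / a) = a' / a := by rw [map_div₀, ha, ha']
    have hx0 : a' / a ≠ 0 := div_ne_zero ha0' ha0
    have hcube : (a' / a) ^ 3 =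
        σ ((T' : Matrix (Fin 3) (Fin 3) K).det * z / (T : Matrix (Fin 3) (Fin 3) K).det) *
          ((T' : Matrix (Fin 3) (Fin 3) K).det * z / (T : Matrix (Fin 3) (Fin 3) K).det) := by
      have hσdetT : σ (T : Matrix (Fin 3) (Fin 3) K).det ≠ 0 := (map_ne_zero σ).2 hdetT
      have key : (a' ^ 3 * (σ (T : Matrix (Fin 3) (Fin 3) K).det * (T : Matrix (Fin 3) (Fin 3) K).det) -
          σ (T' : Matrix (Fin 3) (Fin 3) K).det * σ z * ((T' : Matrix (Fin 3) (Fin 3) K).det * z) * a ^ 3) * H.det = 0 := by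
        linear_combination (-(a' ^ 3)) * hdT + (a ^ 3) * hdT'
      have key' := sub_eq_zero.1 ((mul_eq_zero.1 key).resolve_right hdetH)
      rw [div_pow, map_div₀, map_mul, div_mul_div_comm, div_eq_div_iff (pow_ne_zero 3 ha0) (mul_ne_zero hσdetT hdetT)]
      exact key'
    obtain ⟨u, hu0, hu⟩ := exists_eq_norm_of_pow_three_eq_norm σ hσx hx0 hcube
    -- the scalar frame `u • 1` carries `a • Φ` to `a′ • Φ`; compose `T`, `u • 1`, `T′⁻¹`
    refine ⟨T * Units.map ((Matrix.scalar (Fin 3) : K →+* Matrix (Fin 3) (Fin 3) K) : K →* Matrix (Fin 3) (Fin 3) K)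
      (Units.mk0 u hu0) * T'⁻¹, ?_⟩
    rw [formCongr_mul_eq, formCongr_mul_eq, hT, formCongr_scalar_eq_smul, Units.val_mk0, ← hu, smul_smul,
      div_mul_cancel₀ a' ha0, ← hT', formCongr_inv_formCongr]

end Field

/-! ## §3 At a non-split finite place of a quadratic extension of number fields -/

section Local

variable {F : Type} [Field F] [NumberField F] (E : Type) [Field E] [NumberField E] [Algebra F E]
  [Algebra.IsQuadraticExtension F E] (c : E ≃ₐ[F] E)

/-- **RANK-3 HERMITIAN FORMS AT A NON-SPLIT PLACE ARE CLASSIFIED BY THE DISCRIMINANT** ([Jacobowitz1962, Thm. 3.1]): `c ≠ 1`, `H, H′ ∈ M₃(E)`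
`c`-hermitian with non-zero determinants, `w ∣ v` non-split (`c • w = w`).  Over `E_v = E ⊗_F F_v` (a field): `H_v` and `H′_v` are congruent by some
`T ∈ GL₃(E_v)` iff `det H′_v = (c ⊗ 1) z · z · det H_v` for some unit `z ∈ E_v` — i.e. iff their discriminants agree in `F_vˣ ∕ N(E_wˣ)`.  (Both are
`≅ a • Φ₃`, ★ `exists_formCongr_map_eq_smul_antidiag_of_smul_eq`; then §2.) [cite: Jacobowitz1962, §3 Thm. 3.1] [cite: Rogawski1990, §3.5 p. 29; §14.2 p. 232] -/
theorem nonempty_formCongr_map_eq_iff_exists_det_eq_of_smul_eq (hc : c ≠ 1) (H H' : Matrix (Fin 3) (Fin 3) E)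
    (hHh : (H.map c)ᵀ = H) (hHd : H.det ≠ 0) (hHh' : (H'.map c)ᵀ = H') (hHd' : H'.det ≠ 0)
    {v : HeightOneSpectrum (𝓞 F)} (w : PlacesOver E v) (hw : c • w.1 = w.1) :
    (∃ T : GL (Fin 3) (LocalRing E v),
        formCongr (conjLocal E c v) T (H.map (algebraMap E (LocalRing E v))) = H'.map (algebraMap E (LocalRing E v))) ↔
      ∃ z : LocalRing E v, IsUnit z ∧
        (H'.map (algebraMap E (LocalRing E v))).det = conjLocal E c v z * z * (H.map (algebraMap E (LocalRing E v))).det := by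
  have hE : IsField (LocalRing E v) := LocalRing.isField_of_smul_eq c hc w hw
  obtain ⟨T, a, ha, hσa, hT⟩ := exists_formCongr_map_eq_smul_antidiag_of_smul_eq E c hc H hHh hHd w hw
  obtain ⟨T', a', ha', hσa', hT'⟩ := exists_formCongr_map_eq_smul_antidiag_of_smul_eq E c hc H' hHh' hHd' w hw
  letI : Field (LocalRing E v) := hE.toField
  have hΦ : ((Matrix.of fun i j : Fin 3 => if i.val + j.val + 1 = 3 then (1 : E) else 0).map
      (algebraMap E (LocalRing E v))).det ≠ 0 := by
    rw [← RingHom.mapMatrix_apply, ← RingHom.map_det]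
    exact (map_ne_zero _).2 (isUnit_antidiagOne_det E 3).ne_zero
  rw [nonempty_formCongr_eq_iff_exists_det_eq_of_similar (conjLocal E c v) hΦ ha.ne_zero hσa ha'.ne_zero hσa' hT hT']
  exact ⟨fun ⟨z, hz0, hz⟩ => ⟨z, (IsUnit.mk0 z hz0), hz⟩, fun ⟨z, hz, h⟩ => ⟨z, hz.ne_zero, h⟩⟩

/-- The same with `z` merely non-zero-free: `(∃ T, ᵗ(c⊗1)(T) · H_v · T = H′_v) ↔ ∃ z, det H′_v = (c⊗1) z · z · det H_v` (`z` is then automatically a unit,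
both determinants being units). [cite: Jacobowitz1962, §3 Thm. 3.1] -/
theorem nonempty_formCongr_map_eq_iff_exists_det_eq_of_smul_eq' (hc : c ≠ 1) (H H' : Matrix (Fin 3) (Fin 3) E)
    (hHh : (H.map c)ᵀ = H) (hHd : H.det ≠ 0) (hHh' : (H'.map c)ᵀ = H') (hHd' : H'.det ≠ 0)
    {v : HeightOneSpectrum (𝓞 F)} (w : PlacesOver E v) (hw : c • w.1 = w.1) :
    (∃ T : GL (Fin 3) (LocalRing E v),
        formCongr (conjLocal E c v) T (H.map (algebraMap E (LocalRing E v))) = H'.map (algebraMap E (LocalRing E v))) ↔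
      ∃ z : LocalRing E v,
        (H'.map (algebraMap E (LocalRing E v))).det = conjLocal E c v z * z * (H.map (algebraMap E (LocalRing E v))).det := by
  rw [nonempty_formCongr_map_eq_iff_exists_det_eq_of_smul_eq E c hc H H' hHh hHd hHh' hHd' w hw]
  refine ⟨fun ⟨z, _, h⟩ => ⟨z, h⟩, fun ⟨z, h⟩ => ⟨z, ?_, h⟩⟩
  have hE : IsField (LocalRing E v) := LocalRing.isField_of_smul_eq c hc w hw
  letI : Field (LocalRing E v) := hE.toField
  have hd' : (H'.map (algebraMap E (LocalRing E v))).det ≠ 0 := by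
    rw [← RingHom.mapMatrix_apply, ← RingHom.map_det]; exact (map_ne_zero _).2 hHd'
  refine IsUnit.mk0 z ?_
  rintro rfl
  rw [mul_zero, zero_mul] at h
  exact hd' h

end Local

end Literature.NumberTheory.Automorphic.UnitaryGroup

end
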